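import Literature.NumberTheory.EllipticCurves.PAdicLFunctionBranch
import Literature.NumberTheory.EllipticCurves.PAdicLFunctionInterpolationProofs
import HarnessLib

/-!
# The constant term of the tame branch `L_p(f, α, ω^i, T)`: `∫_{ℤ_p^×} ω^i dμ_{f,α} = ∑_{a mod p^{e₀}} ω(a)^i μ_{f,α}(a + p^{e₀}ℤ_p)` (proofs)

`Proofs` companion of `PAdicLFunctionBranch` (definitions of the `ω^i`-branches, MTT §I.13). Theorems
only; the one auxiliary definition is the Teichmüller representative map `teichRep` (a unit class modulo
`p^{e₀}` ↦ the unique root of unity of `ℤ_p` of order dividing `τ = φ(p^{e₀})` reducing to it;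
Washington §5.1), built as the inverse of the reduction bijection `rootsOfUnity τ ℤ_p ≃ (ℤ/p^{e₀})ˣ`
(`toZModPow_rootsOfUnity_injective` + cardinalities, both tree theorems).

Main results (Mazur–Tate–Teitelbaum 1986, §I.13: the Mellin transform of `μ_{f,α}` at a TAME character
is a finite sum at level `p^{e₀}`):
* `padicLBranchRiemannSum_zero_eq`: for every `n`, the `n`-th Riemann sum of the constant
  coefficient of the `ω^i`-branch equals `∑_{a ∈ (ℤ/p^{e₀})ˣ} μ_{f,α}(a + p^{e₀}ℤ_p) · ω(a)^i`
  (`ω(a) = teichRep a`), granted the distribution relation of `μ_{f,α}` (hypothesis `hdist`, the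
  tree's `msdMeasure_distribution`, discharged for rational newforms and a root `α` of the Hecke
  polynomial by `msdMeasure_distribution_holds`);
* `padicLBranchCoeff_zero_eq`: hence the constant term `∫_{ℤ_p^×} ω^i dμ_{f,α}` of
  `L_p(f, α, ω^i, T)` IS that finite sum (the Riemann sums are constant in `n`).
For odd `p` (`e₀ = 1`) this reads `L_p(f, α, ω^i, 0) = ∑_{a ∈ (ℤ/p)ˣ} ω(a)^i μ_{f,α}(a + pℤ_p)
= α⁻¹ ∑_a ω(a)^i [a/p]⁺_f − α⁻² [0]⁺_f ∑_a ω(a)^i` (definition (10.1) of the measure), the second sum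
vanishing for `i ≢ 0 (mod p − 1)` — the shape MTT (14.3) interpolates at the character `ω^i` of
conductor `p`. Motivation: cell `b2b-bsdres`, seat additive-p4, chain V9 link [D] (the
`ω^{(p−1)/2}`-branch value governs BSD_p at an additive `I₀*`/`I_n*` prime).

References: Mazur–Tate–Teitelbaum, Invent. Math. 84 (1986) §I.10 (10.1), §I.13, §I.14 (14.3)
[MazurTateTeitelbaum1986Invent]; Washington, *Cyclotomic Fields*, §5.1, §7.2.
-/

noncomputable section

open scoped MatrixGroups ModularForm

open CongruenceSubgroup Filter Topology Literature.NumberTheory.EllipticCurves.ModularForms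

namespace Literature.NumberTheory.EllipticCurves

/-! ### Teichmüller representatives of the unit classes modulo `p^{e₀}` -/

section Teich

variable (p : ℕ) [Fact p.Prime]

/-- Reduction of the torsion of `ℤ_p^×` to unit classes modulo `p^{e₀}`:
`η ↦ η mod p^{e₀} ∈ (ℤ/p^{e₀})ˣ` (Washington §5.1). [cite: MazurTateTeitelbaum1986Invent, §I.13] -/
def teichReduce (η : rootsOfUnity (torsionOrder p) ℤ_[p]) : (ZMod (p ^ cyclotomicExponent p))ˣ :=
  Units.map (PadicInt.toZModPow (cyclotomicExponent p) : ℤ_[p] →+* _).toMonoidHom (η : ℤ_[p]ˣ)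

/-- The value of `teichReduce` is the reduction of the underlying `p`-adic integer. [cite: MazurTateTeitelbaum1986Invent, §I.13] -/
@[simp] theorem val_teichReduce (η : rootsOfUnity (torsionOrder p) ℤ_[p]) :
    ((teichReduce p η : (ZMod (p ^ cyclotomicExponent p))ˣ) : ZMod (p ^ cyclotomicExponent p)) =
      PadicInt.toZModPow (cyclotomicExponent p) ((η : ℤ_[p]ˣ) : ℤ_[p]) := rfl

/-- **The reduction `rootsOfUnity τ ℤ_p → (ℤ/p^{e₀})ˣ` is a bijection** (injective by
`toZModPow_rootsOfUnity_injective`; both sides have `τ = φ(p^{e₀})` elements,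
`card_rootsOfUnity_torsionOrder` and `ZMod.card_units_eq_totient`) — i.e. every unit class modulo
`p^{e₀}` has a unique Teichmüller representative (Washington §5.1). [cite: MazurTateTeitelbaum1986Invent, §I.13] -/
theorem teichReduce_bijective : Function.Bijective (teichReduce p) := by
  classical
  haveI := neZero_torsionOrder p
  haveI : NeZero (p ^ cyclotomicExponent p) := ⟨pow_ne_zero _ (Fact.out : p.Prime).ne_zero⟩
  haveI : Fintype (rootsOfUnity (torsionOrder p) ℤ_[p]) := Fintype.ofFinite _
  have hinj : Function.Injective (teichReduce p) := by
    intro η η' h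
    apply toZModPow_rootsOfUnity_injective p
    have h' := congr_arg Units.val h
    simpa only [val_teichReduce] using h'
  refine (Fintype.bijective_iff_injective_and_card _).mpr ⟨hinj, ?_⟩
  rw [← Nat.card_eq_fintype_card, card_rootsOfUnity_torsionOrder, ZMod.card_units_eq_totient]
  rfl

/-- The **Teichmüller representative** `ω(a) ∈ μ_τ(ℤ_p)` of a unit class `a` modulo `p^{e₀}`:
the unique root of unity of order dividing `τ` with `ω(a) ≡ a (mod p^{e₀})` (the inverse of
`teichReduce`; for odd `p`, `e₀ = 1`, this is the Teichmüller character `(ℤ/p)ˣ → μ_{p−1}`)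
(Washington §5.1; Mazur–Tate–Teitelbaum 1986 §I.13, `x = ω(x)⟨x⟩`). [cite: MazurTateTeitelbaum1986Invent, §I.13] -/
def teichRep (a : (ZMod (p ^ cyclotomicExponent p))ˣ) : rootsOfUnity (torsionOrder p) ℤ_[p] :=
  (Equiv.ofBijective (teichReduce p) (teichReduce_bijective p)).symm a

/-- `ω(η mod p^{e₀}) = η` for a root of unity `η`. [cite: MazurTateTeitelbaum1986Invent, §I.13] -/
@[simp] theorem teichRep_teichReduce (η : rootsOfUnity (torsionOrder p) ℤ_[p]) :
    teichRep p (teichReduce p η) = η :=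
  (Equiv.ofBijective (teichReduce p) (teichReduce_bijective p)).symm_apply_apply η

/-- `ω(a) ≡ a (mod p^{e₀})`. [cite: MazurTateTeitelbaum1986Invent, §I.13] -/
@[simp] theorem teichReduce_teichRep (a : (ZMod (p ^ cyclotomicExponent p))ˣ) :
    teichReduce p (teichRep p a) = a :=
  (Equiv.ofBijective (teichReduce p) (teichReduce_bijective p)).apply_symm_apply a

/-- The weight `a ↦ ω(a)^i` on `ℤ/p^{e₀}`, extended by `0` on the non-units (auxiliary, for the
level-`p^{e₀}` reduction of the Riemann sums). [cite: MazurTateTeitelbaum1986Invent, §I.13] -/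
def teichWeight (i : ℕ) (a : ZMod (p ^ cyclotomicExponent p)) : ℚ_[p] :=
  if h : IsUnit a then ((((teichRep p h.unit : rootsOfUnity (torsionOrder p) ℤ_[p]) : ℤ_[p]ˣ) :
    ℤ_[p]) : ℚ_[p]) ^ i else 0

/-- On a unit class the weight is `ω(a)^i`. [cite: MazurTateTeitelbaum1986Invent, §I.13] -/
theorem teichWeight_units (i : ℕ) (a : (ZMod (p ^ cyclotomicExponent p))ˣ) :
    teichWeight p i (a : ZMod (p ^ cyclotomicExponent p)) =
      ((((teichRep p a : rootsOfUnity (torsionOrder p) ℤ_[p]) : ℤ_[p]ˣ) : ℤ_[p]) : ℚ_[p]) ^ i := by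
  unfold teichWeight
  rw [dif_pos (Units.isUnit a), show (Units.isUnit a).unit = a from Units.ext (Units.isUnit a).unit_spec]

/-- The class `η γ^s mod p^{n+e₀}` reduces modulo `p^{e₀}` to `η mod p^{e₀}` (`γ ≡ 1 mod p^{e₀}`), so
its weight is `η^i`. [cite: MazurTateTeitelbaum1986Invent, §I.13] -/
theorem teichWeight_classMap (i n : ℕ) (η : rootsOfUnity (torsionOrder p) ℤ_[p]) (s : ZMod (p ^ n)) :
    teichWeight p i (ZMod.castHom (pow_dvd_pow p (Nat.le_add_left _ n))
        (ZMod (p ^ cyclotomicExponent p))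
        (PadicInt.toZModPow (n + cyclotomicExponent p) ((η : ℤ_[p]ˣ) : ℤ_[p]) *
          (cyclotomicGenerator p : ZMod (p ^ (n + cyclotomicExponent p))) ^ s.val)) =
      ((((η : ℤ_[p]ˣ) : ℤ_[p]) : ℚ_[p])) ^ i := by
  have hle : cyclotomicExponent p ≤ n + cyclotomicExponent p := Nat.le_add_left _ _
  have hred : ZMod.castHom (pow_dvd_pow p hle) (ZMod (p ^ cyclotomicExponent p))
      (PadicInt.toZModPow (n + cyclotomicExponent p) ((η : ℤ_[p]ˣ) : ℤ_[p]) *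
        (cyclotomicGenerator p : ZMod (p ^ (n + cyclotomicExponent p))) ^ s.val) =
      (teichReduce p η : ZMod (p ^ cyclotomicExponent p)) := by
    simp only [map_mul, map_pow, map_natCast, cyclotomicGenerator_cast_cyclotomicExponent, one_pow,
      mul_one, ZMod.castHom_apply, PadicInt.cast_toZModPow _ _ hle, val_teichReduce]
  rw [hred, teichWeight_units, teichRep_teichReduce]

end Teich

/-! ### The constant term of the `ω^i`-branch -/

section ConstantTerm

variable {p : ℕ} [Fact p.Prime] {N : ℕ} {f : CuspForm (Gamma0 N) 2} {α : ℚ_[p]}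

/-- **The Riemann sums for the constant term of the `ω^i`-branch are a fixed finite sum at level
`p^{e₀}`**: for every `n`,
`padicLBranchRiemannSum f α i 0 n = ∑_{a ∈ (ℤ/p^{e₀})ˣ} μ_{f,α}(a + p^{e₀}ℤ_p) · ω(a)^i`
(reindex the classes `η γ^s` as the units modulo `p^{n+e₀}`, `finsum_sum_classes_eq_sum_units`; the
weight `ω^i` factors through the reduction modulo `p^{e₀}`, so the iterated distribution relation
`sum_units_msdMeasure_mul` collapses the sum to level `p^{e₀}`). Hypothesis `hdist` = the distribution
relation of `μ_{f,α}` (tree `msdMeasure_distribution`, proved for rational newforms as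
`msdMeasure_distribution_holds`). Mazur–Tate–Teitelbaum 1986, §I.13 (the Mellin transform at a tame
character). [cite: MazurTateTeitelbaum1986Invent, §I.13] -/
theorem padicLBranchRiemannSum_zero_eq
    (hdist : ∀ (n : ℕ) (a : ZMod (p ^ n)),
      ∑ b ∈ Finset.univ.filter (fun b : ZMod (p ^ (n + 1)) ↦
        ZMod.castHom (pow_dvd_pow p n.le_succ) (ZMod (p ^ n)) b = a), msdMeasure f α (n + 1) b =
        msdMeasure f α n a)
    (i n : ℕ) :
    padicLBranchRiemannSum f α i 0 n =
      ∑ a : (ZMod (p ^ cyclotomicExponent p))ˣ,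
        msdMeasure f α (cyclotomicExponent p) a *
          ((((teichRep p a : rootsOfUnity (torsionOrder p) ℤ_[p]) : ℤ_[p]ˣ) : ℤ_[p]) : ℚ_[p]) ^ i := by
  classical
  have hle : cyclotomicExponent p ≤ n + cyclotomicExponent p := Nat.le_add_left _ _
  have he : 1 ≤ cyclotomicExponent p := Nat.pos_of_ne_zero (cyclotomicExponent_ne_zero p)
  -- the summand as a function of the class `u = η γ^s mod p^{n+e₀}`
  set G : ZMod (p ^ (n + cyclotomicExponent p)) → ℚ_[p] := fun u ↦
    RingHom.id ℚ_[p] (msdMeasure f α (n + cyclotomicExponent p) u) *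
      teichWeight p i (ZMod.castHom (pow_dvd_pow p hle) (ZMod (p ^ cyclotomicExponent p)) u) with hG
  -- Step 1: rewrite the Riemann sum with `G`
  have h1 : padicLBranchRiemannSum f α i 0 n =
      ∑ᶠ η : rootsOfUnity (torsionOrder p) ℤ_[p], ∑ s : ZMod (p ^ n),
        G (PadicInt.toZModPow (n + cyclotomicExponent p) ((η : ℤ_[p]ˣ) : ℤ_[p]) *
          (cyclotomicGenerator p : ZMod (p ^ (n + cyclotomicExponent p))) ^ s.val) := by
    unfold padicLBranchRiemannSum
    refine finsum_congr fun η ↦ Finset.sum_congr rfl fun s _ ↦ ?_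
    rw [hG]
    dsimp only
    rw [RingHom.id_apply, teichWeight_classMap p i n η s, Nat.choose_zero_right, Nat.cast_one,
      mul_one, mul_comm]
  -- Step 2: the classes `η γ^s` are exactly the units modulo `p^{n+e₀}`
  rw [h1, finsum_sum_classes_eq_sum_units p n G]
  -- Step 3: collapse to level `p^{e₀}` by the distribution relation
  have h2 := sum_units_msdMeasure_mul hdist (RingHom.id ℚ_[p]) he hle (teichWeight p i)
  rw [hG]
  dsimp only
  rw [h2]
  refine Finset.sum_congr rfl fun a _ ↦ ?_
  rw [RingHom.id_apply, teichWeight_units]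

/-- **The constant term of the `ω^i`-branch**: `∫_{ℤ_p^×} ω^i dμ_{f,α} = padicLBranchCoeff f α i 0
= ∑_{a ∈ (ℤ/p^{e₀})ˣ} μ_{f,α}(a + p^{e₀}ℤ_p) · ω(a)^i` — for odd `p` (`e₀ = 1`):
`L_p(f, α, ω^i, 0) = ∑_{a ∈ (ℤ/p)ˣ} ω(a)^i μ_{f,α}(a + pℤ_p)` (granted the distribution relation
`hdist`). Mazur–Tate–Teitelbaum 1986, §I.13–I.14. [cite: MazurTateTeitelbaum1986Invent, §I.13] -/
theorem padicLBranchCoeff_zero_eq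
    (hdist : ∀ (n : ℕ) (a : ZMod (p ^ n)),
      ∑ b ∈ Finset.univ.filter (fun b : ZMod (p ^ (n + 1)) ↦
        ZMod.castHom (pow_dvd_pow p n.le_succ) (ZMod (p ^ n)) b = a), msdMeasure f α (n + 1) b =
        msdMeasure f α n a)
    (i : ℕ) :
    padicLBranchCoeff f α i 0 =
      ∑ a : (ZMod (p ^ cyclotomicExponent p))ˣ,
        msdMeasure f α (cyclotomicExponent p) a *
          ((((teichRep p a : rootsOfUnity (torsionOrder p) ℤ_[p]) : ℤ_[p]ˣ) : ℤ_[p]) : ℚ_[p]) ^ i := by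
  unfold padicLBranchCoeff
  exact (tendsto_const_nhds.congr fun n ↦ (padicLBranchRiemannSum_zero_eq hdist i n).symm).limUnder_eq

/-- **The constant term of `L_p(f, α, ω^i, T)` as a power series** (same statement through
`constantCoeff_padicLFunctionBranch`). [cite: MazurTateTeitelbaum1986Invent, §I.13] -/
theorem constantCoeff_padicLFunctionBranch_eq
    (hdist : ∀ (n : ℕ) (a : ZMod (p ^ n)),
      ∑ b ∈ Finset.univ.filter (fun b : ZMod (p ^ (n + 1)) ↦
        ZMod.castHom (pow_dvd_pow p n.le_succ) (ZMod (p ^ n)) b = a), msdMeasure f α (n + 1) b =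
        msdMeasure f α n a)
    (i : ℕ) :
    PowerSeries.constantCoeff (padicLFunctionBranch f α i) =
      ∑ a : (ZMod (p ^ cyclotomicExponent p))ˣ,
        msdMeasure f α (cyclotomicExponent p) a *
          ((((teichRep p a : rootsOfUnity (torsionOrder p) ℤ_[p]) : ℤ_[p]ˣ) : ℤ_[p]) : ℚ_[p]) ^ i := by
  rw [constantCoeff_padicLFunctionBranch, padicLBranchCoeff_zero_eq hdist]

end ConstantTerm

end Literature.NumberTheory.EllipticCurves

end
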